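import Summits.AtomisticToContinuum.Crystallization.Theorems.ExcessDecayLiouvillePhononStabilityDefs

/-!
# Near-certificate layer V7: lattice symmetry at the level of the crux (lead c2, vertex scheme)

Support file for crux `PhononStability` (stmt-AtomisticToContinuum-9333), line `contragredient-window-collapse`.

The crux's forms `nnForm t A u`, `hessForm t A u` depend on the datum `(t, A)` only through the SITE SET
`Sites₀ t A`.  For a linear isometry `S` of `E3` preserving the period lattice `Λ₀` and moving the inner reference
point by a lattice vector (`S ι − ι ∈ Λ₀`; every element of the point group `D_{3h}` of the hcp structure
qualifies), the re-described datum `(t', A') = ((t₀, t₁ + A(Sι − ι)), A ∘ S)` has the SAME site set, and the window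
hypotheses `Adm₀`, `Inner₀` transfer.  Hence stability on the window follows from stability on the window
intersected with any predicate `P` that is reached by such a re-description from every window datum
(`phononStabilityOn_of_redescription`) — the certificate only has to cover a fundamental domain.
-/

noncomputable section

open scoped BigOperators Classical InnerProductSpace
open Filter Set Function
open Literature.MathematicalPhysics.StatisticalMechanics
open Summit.AtomisticToContinuum.Crystallization.Theses.ExcessDecayLiouville
open Summit.AtomisticToContinuum.Crystallization.Theorems.PhononStabilityNegative

namespace Summit.AtomisticToContinuum.Crystallization.Theorems.PhononStabilityCWC

local notation "E3" => EuclideanSpace ℝ (Fin 3)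

/-! ## The period lattice is a subgroup -/

/-- `Λ₀` is closed under addition. [folklore] -/
theorem Λ₀_add_mem {x y : E3} (hx : x ∈ Λ₀) (hy : y ∈ Λ₀) : x + y ∈ Λ₀ := by
  obtain ⟨i, j, k, rfl⟩ := hx
  obtain ⟨i', j', k', rfl⟩ := hy
  refine ⟨i + i', j + j', k + k', ?_⟩
  push_cast
  simp only [add_smul]
  abel

/-- `Λ₀` is closed under negation. [folklore] -/
theorem Λ₀_neg_mem {x : E3} (hx : x ∈ Λ₀) : -x ∈ Λ₀ := by
  obtain ⟨i, j, k, rfl⟩ := hx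
  refine ⟨-i, -j, -k, ?_⟩
  push_cast
  simp only [neg_smul]
  abel

/-- `Λ₀` is closed under subtraction. [folklore] -/
theorem Λ₀_sub_mem {x y : E3} (hx : x ∈ Λ₀) (hy : y ∈ Λ₀) : x - y ∈ Λ₀ := by
  rw [sub_eq_add_neg]; exact Λ₀_add_mem hx (Λ₀_neg_mem hy)

/-! ## Re-description of a datum by a lattice isometry -/

/-- A LATTICE ISOMETRY of the hcp structure: a linear isometry preserving `Λ₀` (both ways) and moving the inner
reference point `ι = innerRef` by a lattice vector. -/
structure LatticeIsometry where
  /-- the isometry -/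
  S : E3 ≃ₗᵢ[ℝ] E3
  /-- `S Λ₀ ⊆ Λ₀` -/
  mapsTo : ∀ z ∈ Λ₀, S z ∈ Λ₀
  /-- `S⁻¹ Λ₀ ⊆ Λ₀` -/
  mapsTo_symm : ∀ z ∈ Λ₀, S.symm z ∈ Λ₀
  /-- `S ι − ι ∈ Λ₀` -/
  shift_mem : S innerRef - innerRef ∈ Λ₀

namespace LatticeIsometry

variable (g : LatticeIsometry)

/-- the re-described cell matrix `A ∘ S` -/
def actA (A : E3 →L[ℝ] E3) : E3 →L[ℝ] E3 := A.comp (g.S.toContinuousLinearEquiv : E3 →L[ℝ] E3)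

/-- the re-described translations `(t₀, t₁ + A(Sι − ι))` -/
def actT (t : Fin 2 → E3) (A : E3 →L[ℝ] E3) : Fin 2 → E3 :=
  fun m => if m = 1 then t 1 + A (g.S innerRef - innerRef) else t 0

/-- the re-described matrix applied. [folklore] -/
@[simp] theorem actA_apply (A : E3 →L[ℝ] E3) (x : E3) : g.actA A x = A (g.S x) := rfl

/-- the re-described translation of sublattice `0`. [folklore] -/
theorem actT_zero (t : Fin 2 → E3) (A : E3 →L[ℝ] E3) : g.actT t A 0 = t 0 := by simp [actT]

/-- the re-described translation of sublattice `1`. [folklore] -/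
theorem actT_one (t : Fin 2 → E3) (A : E3 →L[ℝ] E3) : g.actT t A 1 = t 1 + A (g.S innerRef - innerRef) := by
  simp [actT]

/-- the lattice shift of sublattice `m` under the re-description: `0` and `Sι − ι` -/
def latShift (m : Fin 2) : E3 := if m = 1 then g.S innerRef - innerRef else 0

/-- the lattice shifts lie in the lattice. [folklore] -/
theorem latShift_mem (m : Fin 2) : g.latShift m ∈ Λ₀ := by
  unfold latShift; split_ifs
  · exact g.shift_mem
  · exact zero_mem_Λ₀

/-- the re-described translations as lattice shifts. [folklore] -/
theorem actT_eq (t : Fin 2 → E3) (A : E3 →L[ℝ] E3) (m : Fin 2) : g.actT t A m = t m + A (g.latShift m) := by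
  fin_cases m
  · simp [actT, latShift]
  · simp [actT, latShift]

/-- **THE SITE SET IS INVARIANT under the re-description.** -/
theorem sites_act (t : Fin 2 → E3) (A : E3 →L[ℝ] E3) : Sites₀ (g.actT t A) (g.actA A) = Sites₀ t A := by
  ext p
  simp only [Sites₀, Set.mem_setOf_eq, actA_apply]
  constructor
  · rintro ⟨m, z, hz, rfl⟩
    refine ⟨m, g.latShift m + g.S z, Λ₀_add_mem (g.latShift_mem m) (g.mapsTo z hz), ?_⟩
    rw [actT_eq, map_add]; abel
  · rintro ⟨m, z, hz, rfl⟩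
    refine ⟨m, g.S.symm (z - g.latShift m), g.mapsTo_symm _ (Λ₀_sub_mem hz (g.latShift_mem m)), ?_⟩
    rw [actT_eq, LinearIsometryEquiv.apply_symm_apply, map_sub]; abel

/-- **admissibility transfers.** -/
theorem adm_act {A : E3 →L[ℝ] E3} (hA : Adm₀ A) : Adm₀ (g.actA A) := by
  obtain ⟨R, hR⟩ := hA
  refine ⟨g.S.trans R, ?_⟩
  have h : g.actA A - (97 / 100 : ℝ) • ((g.S.trans R).toContinuousLinearEquiv : E3 →L[ℝ] E3) =
      (A - (97 / 100 : ℝ) • (R.toContinuousLinearEquiv : E3 →L[ℝ] E3)).comp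
        (g.S.toContinuousLinearEquiv : E3 →L[ℝ] E3) := by
    ext x
    simp [actA]
  rw [h]
  refine (ContinuousLinearMap.opNorm_comp_le _ _).trans ?_
  have hS : ‖(g.S.toContinuousLinearEquiv : E3 →L[ℝ] E3)‖ ≤ 1 := by
    refine ContinuousLinearMap.opNorm_le_bound _ zero_le_one fun x => ?_
    simp
  calc ‖A - (97 / 100 : ℝ) • (R.toContinuousLinearEquiv : E3 →L[ℝ] E3)‖ *
        ‖(g.S.toContinuousLinearEquiv : E3 →L[ℝ] E3)‖
      ≤ ‖A - (97 / 100 : ℝ) • (R.toContinuousLinearEquiv : E3 →L[ℝ] E3)‖ * 1 :=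
        mul_le_mul_of_nonneg_left hS (norm_nonneg _)
    _ ≤ 1 / 40 := by rw [mul_one]; exact hR

/-- **the inner-displacement hypothesis transfers** (exactly). -/
theorem inner_act {t : Fin 2 → E3} {A : E3 →L[ℝ] E3} (hI : Inner₀ t A) : Inner₀ (g.actT t A) (g.actA A) := by
  unfold Inner₀ at *
  have h : g.actT t A 1 - g.actT t A 0 - g.actA A (barlowOffset 1 + layerNormal (Real.sqrt (2 / 3))) =
      t 1 - t 0 - A (barlowOffset 1 + layerNormal (Real.sqrt (2 / 3))) := by
    rw [actT_one, actT_zero, actA_apply, map_sub]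
    change t 1 + (A (g.S innerRef) - A innerRef) - t 0 - A (g.S innerRef) = t 1 - t 0 - A innerRef
    abel
  rw [h]; exact hI

/-- **the forms are invariant** (they depend on the datum only through the site set). -/
theorem nnForm_act (t : Fin 2 → E3) (A : E3 →L[ℝ] E3) (u : E3 → E3) :
    nnForm (g.actT t A) (g.actA A) u = nnForm t A u := by
  unfold nnForm; rw [g.sites_act]

/-- the second-variation form is invariant. [folklore] -/
theorem hessForm_act (t : Fin 2 → E3) (A : E3 →L[ℝ] E3) (u : E3 → E3) :
    hessForm (g.actT t A) (g.actA A) u = hessForm t A u := by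
  unfold hessForm; rw [g.sites_act]

end LatticeIsometry

/-! ## Reduction of stability on a window to a fundamental domain -/

/-- **STABILITY FROM A FUNDAMENTAL DOMAIN.**  If every admissible datum is re-described by some lattice isometry
into the predicate `P`, stability on `Adm₀ ∧ Inner₀ ∧ P` gives stability on `Adm₀ ∧ Inner₀`. -/
theorem phononStabilityOn_of_redescription {P : (Fin 2 → E3) → (E3 →L[ℝ] E3) → Prop}
    (hcover : ∀ (t : Fin 2 → E3) (A : E3 →L[ℝ] E3), Adm₀ A → Inner₀ t A →
      ∃ g : LatticeIsometry, P (g.actT t A) (g.actA A))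
    (h : PhononStabilityOn fun t A => Adm₀ A ∧ Inner₀ t A ∧ P t A) :
    PhononStabilityOn fun t A => Adm₀ A ∧ Inner₀ t A := by
  obtain ⟨κ, hκ, hst⟩ := h
  refine ⟨κ, hκ, ?_⟩
  rintro t A ⟨hA, hI⟩ u hu hsupp
  obtain ⟨g, hP⟩ := hcover t A hA hI
  have := hst (g.actT t A) (g.actA A) ⟨g.adm_act hA, g.inner_act hI, hP⟩ u hu (by rw [g.sites_act]; exact hsupp)
  rwa [g.nnForm_act, g.hessForm_act] at this

/-- Anchor of this support file (registered stub of the line skeleton, lead c2): the trivial lattice shift. -/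
theorem stub_certSymm : ∀ g : LatticeIsometry, g.latShift 0 = 0 := fun _ => rfl

end Summit.AtomisticToContinuum.Crystallization.Theorems.PhononStabilityCWC

end
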